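import Summits.BirchSwinnertonDyer.BirchSwinnertonDyer.Theses.KatoDescentPotSupersingular
import Summits.BirchSwinnertonDyer.BirchSwinnertonDyer.Theorems.KatoDescentPotSupersingularReducibleUpperOfCountInputsNodes
import Summits.BirchSwinnertonDyer.Rank1Residual.Additive.X4RankZeroKatoBoundTamagawaExact
import Summits.BirchSwinnertonDyer.Rank1Residual.Additive.QuadraticTwistBSDComparisonIsogeny
import Literature.NumberTheory.EllipticCurves.BSDShaProofs
import HarnessLib

/-!
# Route `KatoDescentPotSupersingular` (rung K9, cell `bsd-potss`), crux L₀ `WildLowerHalfRankZero`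
# (item stmt-BirchSwinnertonDyer-19195) / open core `WildLowerIntrinsicNonCM` (item 19663):
# the PARITY SHADOW of the crux — L₀ forces `ord₃ #Ш_an` EVEN on every row where the upper half is a
# theorem, and ONE such row with ODD `ord₃ #Ш_an` refutes L₀ WITHOUT ANY DESCENT
# (a `--supports stmt-BirchSwinnertonDyer-19663` helper file; closes NOTHING class-wide)

PARTITION (D-0054, cell bsd-potss): EXCLUDED-DOMAIN non-CM additive `p` · B5 O6 wild `3`
(X4 60 568 + X3 18 852 S-b pairs), `r_an = 0`, LOWER half L₀ — types a NECESSARY CONDITION of the crux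
(strength) and a descent-free FALSIFIER (kill criterion); shrinks-literal none.

WHAT THIS FILE PROVES (kernel theorems over DISPLAYED named facts; nothing is asserted, the items are
NOT closed).  The crux asks `ord₃ #Ш_an(W) ≤ ord₃ #Ш(W)` (`MissingLowerBoundAt W 3`) on every wild
`r_an = 0` row.  On the rows where the tree already holds the UPPER half `ord₃ #Ш(W) ≤ ord₃ #Ш_an(W)` as
a theorem modulo named published inputs — (U₀-red) EVERY reducible wild row, by Kato's exact member
count `Kato2004.exists_memberHullCountInputs` + Cassels (seat kmc Part 16,
`ReducibleUpperOfCountInputs.missingUpperBoundAt_of_memberCountInputs`, p451820; the K9 glue 19711 is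
closed on it), and (U₀-surj) every irreducible row with `3`-adic tower image onto, by Kato Thm. 14.5 (3)
⊕ Prop. 14.16 (2) in the Tamagawa-exact reading A161″ (`X4RankZero.missingUpperBoundAt_of_katoTam`) —
the crux gives the EQUALITY `ord₃ #Ш_an = ord₃ #Ш`, and `#Ш` is a SQUARE (Cassels–Tate,
`isSquare_shaOrder_of_casselsTate`, over the named fact `exists_casselsTate_pairing`; `Ш` finite by GZK
in analytic rank `0`).  Hence:

* §1 (route-free, any `p`) `BSD(E,p)`-output ⇒ `ord_p #Ш_an(E)` even; lower half + upper half ⇒ even;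
  upper half + ODD `ord_p #Ш_an` ⇒ ¬ lower half; and `ord_p #Ш_an mod 2` is a `ℚ`-ISOGENY INVARIANT
  (Cassels' defect identity `defectAgreeAt_of_isIsogenous` + squareness at both ends), so the parity
  test may be read at ANY member of a class;
* §2 (K9 rows) `WildLowerHalfRankZero` (resp. `WildLowerIntrinsicNonCM`) ⇒ `ord₃ #Ш_an(W)` is EVEN at
  every reducible wild `r_an = 0` row and at every irreducible tower-onto wild `r_an = 0` row (modulo the
  U₀ inputs named above + Cassels–Tate) — a class-wide arithmetic statement («`#Ш_an` is a square
  `3`-adically on the wild class») that is itself NOT known in print (squareness of `#Ш_an` is a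
  consequence of BSD, verified numerically in Cremona's tables, proved nowhere at a prime where `BSD(E,p)`
  is open): any proof of the crux proves it — a STRENGTH record for the tribunal (T1: `crux ⇒ S′`,
  `S′` open, `S′` strictly weaker in shape);
* §3 (KILL CRITERION, descent-free) ONE globally minimal wild `r_an = 0` curve `W`, reducible at `3` or
  irreducible with tower onto, with `#Ш_an(W) = q` and `ord₃ q` ODD, refutes `WildLowerHalfRankZero`
  (and, if non-CM intrinsic, `WildLowerIntrinsicNonCM`) modulo the same named inputs — the route's
  printed KILL CRITERIA ask for a certified `3`-descent; on the U₀-covered rows an `L`-value parity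
  check suffices.  CENSUS (evidence tier, not a theorem): 0 / 1 770 intrinsic wild `r_an = 0` classes
  with `N < 5·10⁵` have odd `ord₃ #Ш_an` at the `#Ш_an`-minimal member (k9-c2 g4 ledger
  `K9-intrinsic-classes-ledger-v5.tsv`: 1 759 × `ord₃ = 2`, 11 × `ord₃ = 4`; by §1 the parity is the
  same at every member), consistent with Cremona's observation that every tabulated `#Ш_an` is a square.

HONEST FRAMING: BSD is not advanced; the crux (Kato's Conj. 12.10 lower inclusion at the wild additive
potentially supersingular prime `3`) is an open problem (k9-c2 g0–g6 FIND verdict) and stays open; this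
file records what it implies and how it could die cheaply.  Everything is CONDITIONAL on the displayed
named facts (audit `proof.conditional`).  THEOREMS ONLY (no definition, no named fact, no `sorry`).
Seat `bsd-potss-k9-c2` (prover), generation 7.

References: [SilvermanAEC2009] Thm. X.4.14 (Cassels–Tate; `#Ш` a square when finite);
[Cassels1965ArithmeticVIII]; [MilneADT2006] Thm. I.7.3; [Miller2011LMS] §1, Def. 1.1;
[Kato2004Asterisque] Conj. 12.10 (p. 224), Thm. 14.5 (3) (p. 236), proof of Prop. 14.16 (pp. 244–245);
[Cremona1997Algorithms] Table 4 (`#Ш_an`).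
-/

set_option autoImplicit false
-- sibling precedent (`KatoDescentPotSupersingularAssembly.lean`): the directory name repeats the summit name
set_option linter.dupNamespace false

noncomputable section

open scoped Classical

namespace Summit.BirchSwinnertonDyer.BirchSwinnertonDyer.Theorems

open WeierstrassCurve Literature.NumberTheory.EllipticCurves
  Literature.NumberTheory.EllipticCurves.ModularForms
  Literature.NumberTheory.EllipticCurves.Rank1Residual
  Literature.NumberTheory.EllipticCurves.Rank1Residual.Typed
  Summit.BirchSwinnertonDyer.Rank1Residual.Additive
  Summit.BirchSwinnertonDyer.Rank1Residual
  Summit.BirchSwinnertonDyer.BirchSwinnertonDyer.Theses.KatoDescentPotSupersingular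

/-! ## §1 Route-free parity bookkeeping (any prime `p`) -/

section Parity

variable (W : WeierstrassCurve ℚ) [W.IsElliptic] (p : ℕ) [Fact p.Prime]

/-- The `p`-adic valuation of a perfect square is even (`padicValNat p 0 = 0` covers `0 = 0²`).
[folklore] -/
theorem K9Parity.even_padicValNat_of_isSquare {n : ℕ} (h : IsSquare n) :
    Even (padicValNat p n) := by
  obtain ⟨r, rfl⟩ := h
  rcases eq_or_ne r 0 with hr | hr
  · subst hr
    simp
  · rw [padicValNat.mul hr hr]
    exact ⟨_, rfl⟩

/-- **`ord_p #Ш(E)` is even** for finite `Ш` (Cassels–Tate: `#Ш` is a square, tree theorem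
`isSquare_shaOrder_of_casselsTate` over the named fact `exists_casselsTate_pairing`).
[cite: SilvermanAEC2009, Thm. X.4.14] -/
theorem K9Parity.even_padicValNat_shaOrder (hCT : exists_casselsTate_pairing (K := ℚ))
    (hfin : W.ShaFinite) : Even (padicValNat p W.shaOrder) :=
  K9Parity.even_padicValNat_of_isSquare p (isSquare_shaOrder_of_casselsTate hCT W hfin)

/-- **`BSD(E,p)`-output ⇒ `ord_p #Ш_an(E)` even**: if `#Ш_an(E)` is a rational `q₀` with
`ord_p q₀ = ord_p #Ш(E)` (`MissingPPartAt W p`) and `Ш(E)` is finite, then every rational value `q` of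
`#Ш_an(E)` has even `p`-adic valuation (the rational value is unique; `#Ш` is a square).
[cite: SilvermanAEC2009, Thm. X.4.14] [cite: Miller2011LMS, Def. 1.1] -/
theorem K9Parity.even_padicValRat_shaAn_of_missingPPartAt (hCT : exists_casselsTate_pairing (K := ℚ))
    (hfin : W.ShaFinite) (h : MissingPPartAt W p) :
    ∀ q : ℚ, shaAn W = (q : ℂ) → Even (padicValRat p q) := by
  intro q hq
  obtain ⟨q₀, hq₀, hv⟩ := h
  have hqq : q = q₀ := by exact_mod_cast hq.symm.trans hq₀
  subst hqq
  obtain ⟨k, hk⟩ := K9Parity.even_padicValNat_shaOrder W p hCT hfin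
  refine ⟨(k : ℤ), ?_⟩
  rw [hv, hk]
  omega

/-- **Lower half + upper half ⇒ `ord_p #Ш_an(E)` even** (the two typed halves make `MissingPPartAt`,
`missingPPartAt_of_lower_of_upper`). [cite: Miller2011LMS, Def. 1.1] [cite: SilvermanAEC2009, Thm. X.4.14] -/
theorem K9Parity.even_padicValRat_shaAn_of_lower_of_upper (hCT : exists_casselsTate_pairing (K := ℚ))
    (hfin : W.ShaFinite) (hl : MissingLowerBoundAt W p) (hu : MissingUpperBoundAt W p) :
    ∀ q : ℚ, shaAn W = (q : ℂ) → Even (padicValRat p q) :=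
  K9Parity.even_padicValRat_shaAn_of_missingPPartAt W p hCT hfin
    (missingPPartAt_of_lower_of_upper W p hl hu)

/-- **Parity falsifier for the lower half**: where the UPPER half holds and `Ш` is finite, a rational
value `q` of `#Ш_an(E)` with ODD `ord_p q` makes the LOWER half `MissingLowerBoundAt W p` false.
[cite: SilvermanAEC2009, Thm. X.4.14] [cite: Miller2011LMS, Def. 1.1] -/
theorem K9Parity.not_missingLowerBoundAt_of_upper_of_odd (hCT : exists_casselsTate_pairing (K := ℚ))
    (hfin : W.ShaFinite) (hu : MissingUpperBoundAt W p) {q : ℚ} (hq : shaAn W = (q : ℂ))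
    (hodd : Odd (padicValRat p q)) : ¬ MissingLowerBoundAt W p :=
  fun hl ↦ Int.not_even_iff_odd.mpr hodd
    (K9Parity.even_padicValRat_shaAn_of_lower_of_upper W p hCT hfin hl hu q hq)

/-- **`ord_p #Ш_an mod 2` is a `ℚ`-isogeny invariant**: for globally minimal `ℚ`-isogenous `W ∼ W'` with
`Ш(W)` finite and rational values `#Ш_an(W) = q`, `#Ш_an(W') = q'`, the difference
`ord_p q − ord_p q'` is even — Cassels' defect identity `ord_p q − ord_p #Ш(W) = ord_p q' − ord_p #Ш(W')`
(`TwistComparison.defectAgreeAt_of_isIsogenous`, over Cassels `hCassels` and modularity `hmod`) with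
`#Ш(W)`, `#Ш(W')` both squares (Cassels–Tate `hCT`; `Ш(W')` finite by Cassels).  So on a `ℚ`-isogeny
class either every member has even `ord_p #Ш_an` or every member has odd `ord_p #Ш_an`.
[cite: Cassels1965ArithmeticVIII] [cite: MilneADT2006, Thm. I.7.3] [cite: SilvermanAEC2009, Thm. X.4.14] -/
theorem K9Parity.even_padicValRat_shaAn_sub_of_isIsogenous (hCassels : bsdRHS_eq_of_isIsogenous)
    (hmod : hasEntireLFunction_rat) (hCT : exists_casselsTate_pairing (K := ℚ))
    (W' : WeierstrassCurve ℚ) [W'.IsElliptic] [W.IsGloballyMinimal] [W'.IsGloballyMinimal]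
    (hiso : IsIsogenous W W') (hfin : W.ShaFinite) {q q' : ℚ} (hq : shaAn W = (q : ℂ))
    (hq' : shaAn W' = (q' : ℂ)) : Even (padicValRat p q - padicValRat p q') := by
  obtain ⟨hfin', -⟩ := hCassels W W' hiso hfin
  obtain ⟨q₁, q₁', hq₁, hq₁', hdef⟩ :=
    TwistComparison.defectAgreeAt_of_isIsogenous W W' p hCassels hmod hiso hfin hq
  have h1 : q₁ = q := by exact_mod_cast hq₁.symm.trans hq
  have h2 : q₁' = q' := by exact_mod_cast hq₁'.symm.trans hq'
  subst h1 h2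
  obtain ⟨a, ha⟩ := K9Parity.even_padicValNat_shaOrder W p hCT hfin
  obtain ⟨b, hb⟩ := K9Parity.even_padicValNat_shaOrder W' p hCT hfin'
  refine ⟨(a : ℤ) - b, ?_⟩
  have hdef' : padicValRat p q₁ - padicValRat p q₁' =
      (padicValNat p W.shaOrder : ℤ) - (padicValNat p W'.shaOrder : ℤ) := by linarith
  rw [hdef', ha, hb]
  omega

end Parity

/-! ## §2 The parity shadow of the crux on the U₀-covered wild rows -/

section Wild

/-- **L₀ at a REDUCIBLE wild row ⇒ `ord₃ #Ш_an` even.**  On a globally minimal `W` with `r_an = 0`,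
`ClassO6 W 3` and `W[3]` reducible, the UPPER half is the tree theorem
`ReducibleUpperOfCountInputs.missingUpperBoundAt_of_memberCountInputs` modulo Kato's `𝐇¹` data `hne`,
modularity `hmodN`/`hmodL`, Kato's sharp member count `hin`, Cassels `hCassels`, GZK `hGZK`; with the
lower half `hl` and Cassels–Tate `hCT` every rational value of `#Ш_an(W)` has even `3`-adic valuation.
Conditional; nothing asserted.
[cite: Kato2004Asterisque, proof of Prop. 14.16 (pp. 244–245)] [cite: Cassels1965ArithmeticVIII]
[cite: SilvermanAEC2009, Thm. X.4.14] [cite: Miller2011LMS, Def. 1.1] -/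
theorem K9Parity.even_padicValRat_shaAn_wild_red_of_lower (hne : Kato2004.nonempty_iwasawaH1Data)
    (hmodN : exists_isNewformOf) (hin : Kato2004.exists_memberHullCountInputs)
    (hCassels : bsdRHS_eq_of_isIsogenous) (hGZK : rank_eq_analyticRank_of_analyticRank_le_one)
    (hmodL : hasEntireLFunction_rat) (hCT : exists_casselsTate_pairing (K := ℚ))
    (W : WeierstrassCurve ℚ) [W.IsElliptic] [W.IsGloballyMinimal] [Fact (3 : ℕ).Prime]
    (hr : W.analyticRank = 0) (hO : ClassO6 W 3) (hred : ¬ Irr W 3) (hl : MissingLowerBoundAt W 3) :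
    ∀ q : ℚ, shaAn W = (q : ℂ) → Even (padicValRat 3 q) := by
  have hfin : W.ShaFinite := (hGZK W (by rw [hr]; exact zero_le_one)).2
  have hu : MissingUpperBoundAt W 3 :=
    ReducibleUpperOfCountInputs.missingUpperBoundAt_of_memberCountInputs hne hmodN hin hCassels hGZK
      hmodL W 3 hO.1 hO.2.1.1 hO.2.1.2 hO.padicValRat_j_nonneg hred hr
  exact K9Parity.even_padicValRat_shaAn_of_lower_of_upper W 3 hCT hfin hl hu

/-- **L₀ at an IRREDUCIBLE wild row with `3`-adic tower onto ⇒ `ord₃ #Ш_an` even.**  The UPPER half is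
`X4RankZero.missingUpperBoundAt_of_katoTam` (Kato Thm. 14.5 (3) ⊕ Prop. 14.16 (2), Tamagawa-exact
reading A161″ `hKatoT`, GZK, modularity; tower onto = (12.5.2)); with the lower half and Cassels–Tate the
valuation is even.  Conditional; nothing asserted.
[cite: Kato2004Asterisque, Thm. 14.5 (3) (p. 236), Prop. 14.16 (2) (p. 244), (12.5.2) (p. 222)]
[cite: SilvermanAEC2009, Thm. X.4.14] [cite: Miller2011LMS, Def. 1.1] -/
theorem K9Parity.even_padicValRat_shaAn_wild_towerSurj_of_lower
    (hKatoT : Kato2004.rankZero_padicValNat_sha_add_padicValNat_tamagawa_le_of_additive_potGood_of_imageContainsSL2)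
    (hGZK : rank_eq_analyticRank_of_analyticRank_le_one) (hmodL : hasEntireLFunction_rat)
    (hCT : exists_casselsTate_pairing (K := ℚ))
    (W : WeierstrassCurve ℚ) [W.IsElliptic] [W.IsGloballyMinimal] [Fact (3 : ℕ).Prime]
    (hr : W.analyticRank = 0) (hO : ClassO6 W 3) (hirr : Irr W 3)
    (hsurj : ∀ n : ℕ, W.HasSurjectiveModNGaloisRep (3 ^ n : ℕ)) (hl : MissingLowerBoundAt W 3) :
    ∀ q : ℚ, shaAn W = (q : ℂ) → Even (padicValRat 3 q) := by
  have hfin : W.ShaFinite := (hGZK W (by rw [hr]; exact zero_le_one)).2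
  have hu : MissingUpperBoundAt W 3 :=
    X4RankZero.missingUpperBoundAt_of_katoTam W 3 hKatoT hGZK hmodL hr ⟨hO.1, hO.2.1, hirr⟩
      hO.padicValRat_j_nonneg hsurj
  exact K9Parity.even_padicValRat_shaAn_of_lower_of_upper W 3 hCT hfin hl hu

/-- **THE PARITY SHADOW OF THE CRUX (reducible rows)**: `WildLowerHalfRankZero` (item 19195) implies,
modulo the U₀-red inputs and Cassels–Tate, that `ord₃ #Ш_an(W)` is EVEN at every globally minimal wild
`r_an = 0` curve with `W[3]` reducible — a class-wide `3`-adic squareness statement not known in print.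
STRENGTH record; conditional; the item is NOT closed.
[cite: Kato2004Asterisque, Conj. 12.10 (p. 224), proof of Prop. 14.16 (pp. 244–245)]
[cite: SilvermanAEC2009, Thm. X.4.14] -/
theorem K9Parity.even_padicValRat_shaAn_red_of_wildLowerHalfRankZero (hL : WildLowerHalfRankZero)
    (hne : Kato2004.nonempty_iwasawaH1Data) (hmodN : exists_isNewformOf)
    (hin : Kato2004.exists_memberHullCountInputs) (hCassels : bsdRHS_eq_of_isIsogenous)
    (hGZK : rank_eq_analyticRank_of_analyticRank_le_one) (hmodL : hasEntireLFunction_rat)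
    (hCT : exists_casselsTate_pairing (K := ℚ)) :
    ∀ (W : WeierstrassCurve ℚ) [W.IsElliptic] [W.IsGloballyMinimal] [Fact (3 : ℕ).Prime],
      W.analyticRank = 0 → ClassO6 W 3 → ¬ Irr W 3 →
      ∀ q : ℚ, shaAn W = (q : ℂ) → Even (padicValRat 3 q) :=
  fun W _ _ _ hr hO hred ↦
    K9Parity.even_padicValRat_shaAn_wild_red_of_lower hne hmodN hin hCassels hGZK hmodL hCT W hr hO hred
      (hL W hr hO)

/-- **THE PARITY SHADOW OF THE CRUX (tower-onto irreducible rows)**: `WildLowerHalfRankZero` implies,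
modulo A161″, GZK, modularity and Cassels–Tate, that `ord₃ #Ш_an(W)` is EVEN at every globally minimal
wild `r_an = 0` curve with `W[3]` irreducible and `3`-adic tower image onto.  STRENGTH record;
conditional; the item is NOT closed.
[cite: Kato2004Asterisque, Conj. 12.10 (p. 224), Thm. 14.5 (3) (p. 236)] [cite: SilvermanAEC2009, Thm. X.4.14] -/
theorem K9Parity.even_padicValRat_shaAn_towerSurj_of_wildLowerHalfRankZero (hL : WildLowerHalfRankZero)
    (hKatoT : Kato2004.rankZero_padicValNat_sha_add_padicValNat_tamagawa_le_of_additive_potGood_of_imageContainsSL2)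
    (hGZK : rank_eq_analyticRank_of_analyticRank_le_one) (hmodL : hasEntireLFunction_rat)
    (hCT : exists_casselsTate_pairing (K := ℚ)) :
    ∀ (W : WeierstrassCurve ℚ) [W.IsElliptic] [W.IsGloballyMinimal] [Fact (3 : ℕ).Prime],
      W.analyticRank = 0 → ClassO6 W 3 → Irr W 3 →
      (∀ n : ℕ, W.HasSurjectiveModNGaloisRep (3 ^ n : ℕ)) →
      ∀ q : ℚ, shaAn W = (q : ℂ) → Even (padicValRat 3 q) :=
  fun W _ _ _ hr hO hirr hsurj ↦
    K9Parity.even_padicValRat_shaAn_wild_towerSurj_of_lower hKatoT hGZK hmodL hCT W hr hO hirr hsurj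
      (hL W hr hO)

/-- **The same for the open core `WildLowerIntrinsicNonCM` (item 19663), reducible rows**: on its own
rows (non-CM, intrinsic class) the core implies `ord₃ #Ш_an(W)` even, modulo the U₀-red inputs and
Cassels–Tate.  STRENGTH record; conditional; the item is NOT closed.
[cite: Kato2004Asterisque, Conj. 12.10 (p. 224), proof of Prop. 14.16 (pp. 244–245)]
[cite: SilvermanAEC2009, Thm. X.4.14] -/
theorem K9Parity.even_padicValRat_shaAn_red_of_wildLowerIntrinsicNonCM (hL : WildLowerIntrinsicNonCM)
    (hne : Kato2004.nonempty_iwasawaH1Data) (hmodN : exists_isNewformOf)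
    (hin : Kato2004.exists_memberHullCountInputs) (hCassels : bsdRHS_eq_of_isIsogenous)
    (hGZK : rank_eq_analyticRank_of_analyticRank_le_one) (hmodL : hasEntireLFunction_rat)
    (hCT : exists_casselsTate_pairing (K := ℚ)) :
    ∀ (W : WeierstrassCurve ℚ) [W.IsElliptic] [W.IsGloballyMinimal] [Fact (3 : ℕ).Prime],
      W.analyticRank = 0 → ClassO6 W 3 → ¬ Irr W 3 → ¬ W.HasCM →
      (∀ (W' : WeierstrassCurve ℚ) [W'.IsElliptic] [W'.IsGloballyMinimal], IsIsogenous W W' →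
        ∀ q' : ℚ, shaAn W' = (q' : ℂ) → 0 < padicValRat 3 q') →
      ∀ q : ℚ, shaAn W = (q : ℂ) → Even (padicValRat 3 q) :=
  fun W _ _ _ hr hO hred hCM hI ↦
    K9Parity.even_padicValRat_shaAn_wild_red_of_lower hne hmodN hin hCassels hGZK hmodL hCT W hr hO hred
      (hL W hr hO hCM hI)

/-! ## §3 Kill criterion: one U₀-covered wild row with odd `ord₃ #Ш_an` refutes the crux (descent-free) -/

/-- **KILL CRITERION (reducible rows)**: a globally minimal wild `r_an = 0` curve `W` with `W[3]`
reducible and a rational value `#Ш_an(W) = q` of ODD `3`-adic valuation refutes `WildLowerHalfRankZero`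
(item 19195), modulo the U₀-red inputs and Cassels–Tate.  (BSD + Cassels–Tate predict no such curve;
census: none among the 1 770 intrinsic classes with `N < 5·10⁵`.)  Conditional; nothing asserted.
[cite: Kato2004Asterisque, proof of Prop. 14.16 (pp. 244–245)] [cite: SilvermanAEC2009, Thm. X.4.14]
[cite: Cremona1997Algorithms, Table 4] -/
theorem K9Parity.not_wildLowerHalfRankZero_of_odd_red (hne : Kato2004.nonempty_iwasawaH1Data)
    (hmodN : exists_isNewformOf) (hin : Kato2004.exists_memberHullCountInputs)
    (hCassels : bsdRHS_eq_of_isIsogenous) (hGZK : rank_eq_analyticRank_of_analyticRank_le_one)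
    (hmodL : hasEntireLFunction_rat) (hCT : exists_casselsTate_pairing (K := ℚ))
    (W : WeierstrassCurve ℚ) [W.IsElliptic] [W.IsGloballyMinimal] [Fact (3 : ℕ).Prime]
    (hr : W.analyticRank = 0) (hO : ClassO6 W 3) (hred : ¬ Irr W 3) {q : ℚ}
    (hq : shaAn W = (q : ℂ)) (hodd : Odd (padicValRat 3 q)) : ¬ WildLowerHalfRankZero :=
  fun hL ↦ Int.not_even_iff_odd.mpr hodd
    (K9Parity.even_padicValRat_shaAn_red_of_wildLowerHalfRankZero hL hne hmodN hin hCassels hGZK hmodL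
      hCT W hr hO hred q hq)

/-- **KILL CRITERION (tower-onto irreducible rows)**: a globally minimal wild `r_an = 0` curve `W` with
`W[3]` irreducible, `3`-adic tower image onto and `#Ш_an(W) = q` of ODD `3`-adic valuation refutes
`WildLowerHalfRankZero`, modulo A161″, GZK, modularity and Cassels–Tate.  Conditional; nothing asserted.
[cite: Kato2004Asterisque, Thm. 14.5 (3) (p. 236)] [cite: SilvermanAEC2009, Thm. X.4.14] -/
theorem K9Parity.not_wildLowerHalfRankZero_of_odd_towerSurj
    (hKatoT : Kato2004.rankZero_padicValNat_sha_add_padicValNat_tamagawa_le_of_additive_potGood_of_imageContainsSL2)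
    (hGZK : rank_eq_analyticRank_of_analyticRank_le_one) (hmodL : hasEntireLFunction_rat)
    (hCT : exists_casselsTate_pairing (K := ℚ))
    (W : WeierstrassCurve ℚ) [W.IsElliptic] [W.IsGloballyMinimal] [Fact (3 : ℕ).Prime]
    (hr : W.analyticRank = 0) (hO : ClassO6 W 3) (hirr : Irr W 3)
    (hsurj : ∀ n : ℕ, W.HasSurjectiveModNGaloisRep (3 ^ n : ℕ)) {q : ℚ}
    (hq : shaAn W = (q : ℂ)) (hodd : Odd (padicValRat 3 q)) : ¬ WildLowerHalfRankZero := by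
  intro hL
  have hfin : W.ShaFinite := (hGZK W (by rw [hr]; exact zero_le_one)).2
  have hu : MissingUpperBoundAt W 3 :=
    X4RankZero.missingUpperBoundAt_of_katoTam W 3 hKatoT hGZK hmodL hr ⟨hO.1, hO.2.1, hirr⟩
      hO.padicValRat_j_nonneg hsurj
  exact K9Parity.not_missingLowerBoundAt_of_upper_of_odd W 3 hCT hfin hu hq hodd (hL W hr hO)

/-- **KILL CRITERION read at ANY member (reducible rows)**: if `W` is a reducible wild `r_an = 0` row and
SOME globally minimal `W' ∼_ℚ W` has `#Ш_an(W') = q'` with ODD `ord₃ q'`, then `WildLowerHalfRankZero`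
fails — the parity of `ord₃ #Ш_an` is a class invariant (`even_padicValRat_shaAn_sub_of_isIsogenous`), so
the odd member need not itself be the row tested.  Modulo the U₀-red inputs and Cassels–Tate; nothing
asserted. [cite: Cassels1965ArithmeticVIII] [cite: SilvermanAEC2009, Thm. X.4.14]
[cite: Kato2004Asterisque, proof of Prop. 14.16 (pp. 244–245)] -/
theorem K9Parity.not_wildLowerHalfRankZero_of_odd_member_red (hne : Kato2004.nonempty_iwasawaH1Data)
    (hmodN : exists_isNewformOf) (hin : Kato2004.exists_memberHullCountInputs)
    (hCassels : bsdRHS_eq_of_isIsogenous) (hGZK : rank_eq_analyticRank_of_analyticRank_le_one)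
    (hmodL : hasEntireLFunction_rat) (hCT : exists_casselsTate_pairing (K := ℚ))
    (W W' : WeierstrassCurve ℚ) [W.IsElliptic] [W'.IsElliptic] [W.IsGloballyMinimal]
    [W'.IsGloballyMinimal] [Fact (3 : ℕ).Prime]
    (hr : W.analyticRank = 0) (hO : ClassO6 W 3) (hred : ¬ Irr W 3) (hiso : IsIsogenous W W')
    {q' : ℚ} (hq' : shaAn W' = (q' : ℂ)) (hodd : Odd (padicValRat 3 q')) : ¬ WildLowerHalfRankZero := by
  intro hL
  have hfin : W.ShaFinite := (hGZK W (by rw [hr]; exact zero_le_one)).2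
  obtain ⟨q, hq, -⟩ := hL W hr hO
  have heven : Even (padicValRat 3 q) :=
    K9Parity.even_padicValRat_shaAn_red_of_wildLowerHalfRankZero hL hne hmodN hin hCassels hGZK hmodL hCT
      W hr hO hred q hq
  have hsub : Even (padicValRat 3 q - padicValRat 3 q') :=
    K9Parity.even_padicValRat_shaAn_sub_of_isIsogenous W 3 hCassels hmodL hCT W' hiso hfin hq hq'
  have hq'even : Even (padicValRat 3 q') := by
    have h := heven.sub hsub
    rwa [sub_sub_cancel] at h
  exact Int.not_even_iff_odd.mpr hodd hq'even

/-- **KILL CRITERION read at ANY member (tower-onto irreducible rows)**: as above on an irreducible wild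
`r_an = 0` row with `3`-adic tower onto, the odd valuation being observed at any globally minimal
`W' ∼_ℚ W`.  Modulo A161″, Cassels, GZK, modularity and Cassels–Tate; nothing asserted.
[cite: Cassels1965ArithmeticVIII] [cite: SilvermanAEC2009, Thm. X.4.14] [cite: Kato2004Asterisque, Thm. 14.5 (3) (p. 236)] -/
theorem K9Parity.not_wildLowerHalfRankZero_of_odd_member_towerSurj
    (hKatoT : Kato2004.rankZero_padicValNat_sha_add_padicValNat_tamagawa_le_of_additive_potGood_of_imageContainsSL2)
    (hCassels : bsdRHS_eq_of_isIsogenous) (hGZK : rank_eq_analyticRank_of_analyticRank_le_one)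
    (hmodL : hasEntireLFunction_rat) (hCT : exists_casselsTate_pairing (K := ℚ))
    (W W' : WeierstrassCurve ℚ) [W.IsElliptic] [W'.IsElliptic] [W.IsGloballyMinimal]
    [W'.IsGloballyMinimal] [Fact (3 : ℕ).Prime]
    (hr : W.analyticRank = 0) (hO : ClassO6 W 3) (hirr : Irr W 3)
    (hsurj : ∀ n : ℕ, W.HasSurjectiveModNGaloisRep (3 ^ n : ℕ)) (hiso : IsIsogenous W W')
    {q' : ℚ} (hq' : shaAn W' = (q' : ℂ)) (hodd : Odd (padicValRat 3 q')) : ¬ WildLowerHalfRankZero := by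
  intro hL
  have hfin : W.ShaFinite := (hGZK W (by rw [hr]; exact zero_le_one)).2
  obtain ⟨q, hq, -⟩ := hL W hr hO
  have heven : Even (padicValRat 3 q) :=
    K9Parity.even_padicValRat_shaAn_towerSurj_of_wildLowerHalfRankZero hL hKatoT hGZK hmodL hCT W hr hO
      hirr hsurj q hq
  have hsub : Even (padicValRat 3 q - padicValRat 3 q') :=
    K9Parity.even_padicValRat_shaAn_sub_of_isIsogenous W 3 hCassels hmodL hCT W' hiso hfin hq hq'
  have hq'even : Even (padicValRat 3 q') := by
    have h := heven.sub hsub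
    rwa [sub_sub_cancel] at h
  exact Int.not_even_iff_odd.mpr hodd hq'even

/-- **KILL CRITERION for the open core `WildLowerIntrinsicNonCM` (item 19663)**: a non-CM globally
minimal wild `r_an = 0` curve with `W[3]` reducible, intrinsic class, and `#Ш_an(W) = q` of ODD
`3`-adic valuation refutes the core, modulo the U₀-red inputs and Cassels–Tate.  By
`K9Parity.even_padicValRat_shaAn_sub_of_isIsogenous` the parity may be read at any member of the
class.  Conditional; nothing asserted.
[cite: Kato2004Asterisque, Conj. 12.10 (p. 224), proof of Prop. 14.16 (pp. 244–245)]
[cite: SilvermanAEC2009, Thm. X.4.14] -/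
theorem K9Parity.not_wildLowerIntrinsicNonCM_of_odd_red (hne : Kato2004.nonempty_iwasawaH1Data)
    (hmodN : exists_isNewformOf) (hin : Kato2004.exists_memberHullCountInputs)
    (hCassels : bsdRHS_eq_of_isIsogenous) (hGZK : rank_eq_analyticRank_of_analyticRank_le_one)
    (hmodL : hasEntireLFunction_rat) (hCT : exists_casselsTate_pairing (K := ℚ))
    (W : WeierstrassCurve ℚ) [W.IsElliptic] [W.IsGloballyMinimal] [Fact (3 : ℕ).Prime]
    (hr : W.analyticRank = 0) (hO : ClassO6 W 3) (hred : ¬ Irr W 3) (hCM : ¬ W.HasCM)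
    (hI : ∀ (W' : WeierstrassCurve ℚ) [W'.IsElliptic] [W'.IsGloballyMinimal], IsIsogenous W W' →
      ∀ q' : ℚ, shaAn W' = (q' : ℂ) → 0 < padicValRat 3 q')
    {q : ℚ} (hq : shaAn W = (q : ℂ)) (hodd : Odd (padicValRat 3 q)) : ¬ WildLowerIntrinsicNonCM :=
  fun hL ↦ Int.not_even_iff_odd.mpr hodd
    (K9Parity.even_padicValRat_shaAn_red_of_wildLowerIntrinsicNonCM hL hne hmodN hin hCassels hGZK hmodL
      hCT W hr hO hred hCM hI q hq)

end Wild

end Summit.BirchSwinnertonDyer.BirchSwinnertonDyer.Theorems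

end
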